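import Summits.HodgeConjecture.HodgeConjecture.Theorems.PadicSemiregularLiftHodgeFermatVarietiesPairedOfLargePrimesBoundary
import Literature.AlgebraicGeometry.HodgeTheory.FermatHodgeLevelGlue
import HarnessLib

/-!
# Short character-sum configurations, VI: even or a full fibre; the arithmetic kill

Crux `HodgeFermatVarieties` (stmt-HodgeConjecture-1334), line `cancel-by-any-claim-lattice`, stub S6
`stub_pairedOfLargePrimes` (lead c2), boundary prime `p₀`.

* `even_or_fibre_of_boundary` — THE DICHOTOMY: a `{0,1}`-valued configuration `T` on `ℤ/(p₀ n)`
  (`p₀ ∤ n`, all primes `≥ 5`), supported on units, annihilated by every odd primitive character, with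
  room `#supp T + 1 < p'` at the primes `p'` of `n`, is EITHER even, OR contains a full fibre
  `{crt⁻¹(y, b) : y ∈ (ℤ/p₀)ˣ}` (pieces + fibre constancy of part V: a point `z₀` with
  `T(-z₀) ≠ T(z₀)` makes `y ↦ T(crt⁻¹(y, b₀)) - T(-crt⁻¹(y, b₀))` the non-zero constant `±1`).
* `exists_odd_isPrimitive_apply_natCast_ne_one` — THE KILL: if `n > 1` has all prime factors
  `≥ p₀ + 2` (`p₀ ≥ 5` prime), no residue class of `p₀` mod `n` is annihilated by all odd primitive
  characters: `p₀² ≢ 1 (mod n)` because every prime factor of `p₀² - 1` is `< p₀`, and Aoki's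
  `U(n) ⊆ {w : w² = 1}` (`exists_odd_isPrimitive_apply_ne_one_of_sq_ne_one`).

Everything here is proved; no named facts. Part VII applies this to Hodge characters.

References: [Aoki1983] N. Aoki, Math. Ann. 266 (1983) 23–54, Prop. 6.1, Prop. 6.4, §9.
-/

set_option linter.dupNamespace false

noncomputable section

open Finset
open Literature.AlgebraicGeometry.HodgeTheory Literature.AlgebraicGeometry.HodgeTheory.FermatCharacter

namespace Summit.HodgeConjecture.HodgeConjecture.Theorems.CancelByAnyClaimLattice

namespace PairedNull

section Dichotomy

variable {p₀ n : ℕ} [NeZero p₀] [NeZero n]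

/-- `πq[p']` — reduction from level `p₀ · n` to the prime power `p' ^ v_{p'}(n)` of `n`. Local notation. -/
local notation3 (prettyPrint := false) "πq[" p' "]" =>
  ZMod.castHom ((Nat.ordProj_dvd n p').trans (dvd_mul_left n p₀)) (ZMod (p' ^ n.factorization p'))

/-- `Reg[P, x, z]` — `z ≡ ±x` modulo `p' ^ v_{p'}(n)` for every `p' ∈ P`. Local notation. -/
local notation3 (prettyPrint := false) "Reg[" P ", " x ", " z "]" =>
  ∀ p' ∈ (P : Finset ℕ), πq[p'] z = πq[p'] x ∨ πq[p'] z = -(πq[p'] x)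

/-- **Even, or a full fibre.** Let `p₀ ≥ 5` be a prime not dividing `n`, all prime factors of `n`
`≥ 5`, and let `T : ℤ/(p₀ n) → ℂ` take only the values `0, 1`, vanish off the units, be annihilated
by every odd primitive character mod `p₀ n`, and have `#supp T + 1 < p'` for every prime `p' ∣ n`.
Then either `T(-z) = T(z)` for all `z`, or for some unit `b` mod `n` the whole fibre
`{crt⁻¹(y, b) : y a unit mod p₀}` lies in the support of `T`. [cite: Aoki1983, Prop. 6.4 and §9] -/
theorem even_or_fibre_of_boundary (hp₀ : p₀.Prime) (hp₀5 : 5 ≤ p₀) (hp₀n : ¬ p₀ ∣ n)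
    (hn5 : ∀ p' ∈ n.primeFactors, 5 ≤ p') (hc : p₀.Coprime n)
    (T : ZMod (p₀ * n) → ℂ) (h01 : ∀ z, T z = 0 ∨ T z = 1) (hTu : ∀ z, ¬ IsUnit z → T z = 0)
    (hT : ∀ χ : DirichletCharacter ℂ (p₀ * n), χ.Odd → χ.IsPrimitive → ∑ z : ZMod (p₀ * n), T z * χ z = 0)
    (hroom : ∀ p' ∈ n.primeFactors, #(univ.filter fun z : ZMod (p₀ * n) ↦ T z ≠ 0) + 1 < p') :
    (∀ z, T (-z) = T z) ∨
      ∃ b : ZMod n, IsUnit b ∧ ∀ y : (ZMod p₀)ˣ, T ((ZMod.chineseRemainder hc).symm (y, b)) = 1 := by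
  classical
  by_cases hev : ∀ z, T (-z) = T z
  · exact Or.inl hev
  right
  push Not at hev
  obtain ⟨z₀, hz₀⟩ := hev
  have hz₀u : IsUnit z₀ := by
    by_contra hnu
    exact hz₀ (by rw [hTu z₀ hnu, hTu (-z₀) (fun h ↦ hnu (by simpa using h.neg))])
  -- the piece of `T` around `z₀`
  set Tp : ZMod (p₀ * n) → ℂ := fun z ↦ if Reg[n.primeFactors, z₀, z] then T z else 0 with hTp
  have hTpann := piece_annihilated hp₀ hp₀5 hp₀n hn5 T hTu hT hroom hz₀u n.primeFactors (subset_refl _)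
  have hTpsupp : ∀ z, Tp z ≠ 0 → IsUnit z ∧ Reg[n.primeFactors, z₀, z] := by
    intro z hz
    by_cases hreg : Reg[n.primeFactors, z₀, z]
    · refine ⟨?_, hreg⟩
      by_contra hnu
      exact hz (by simp only [hTp, if_pos hreg, hTu z hnu])
    · exact absurd (by simp only [hTp, if_neg hreg]) hz
  have hTpval : ∀ z, Tp z ≠ 0 → Tp z = T z := by
    intro z hz
    by_cases hreg : Reg[n.primeFactors, z₀, z]
    · simp only [hTp, if_pos hreg]
    · exact absurd (by simp only [hTp, if_neg hreg]) hz
  have hTpz₀ : Tp z₀ = T z₀ := by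
    simp only [hTp, if_pos (fun p' _ ↦ Or.inl rfl)]
  have hTpnz₀ : Tp (-z₀) = T (-z₀) := by
    simp only [hTp]
    rw [if_pos]
    intro p' _
    right
    rw [map_neg]
  -- coordinates of `z₀`
  set y₀u : (ZMod p₀)ˣ := (hz₀u.map (ZMod.castHom (dvd_mul_right p₀ n) (ZMod p₀))).unit with hy₀u
  set b₀ : ZMod n := ZMod.castHom (dvd_mul_left n p₀) (ZMod n) z₀ with hb₀
  have hb₀u : IsUnit b₀ := hz₀u.map _
  have hz₀eq : (ZMod.chineseRemainder hc).symm ((y₀u : ZMod p₀), b₀) = z₀ := by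
    rw [hy₀u, IsUnit.unit_spec]; exact crt_symm_castHom hc z₀
  -- fibre constancy: `D y = D 1 = D y₀ = T z₀ - T(-z₀)`
  have hconst := fun y ↦ fibre_const_of_piece hp₀ hc hn5 Tp hTpann hz₀u hTpsupp b₀ y
  have hDy₀ : Tp ((ZMod.chineseRemainder hc).symm (1, b₀)) - Tp (-(ZMod.chineseRemainder hc).symm (1, b₀)) =
      T z₀ - T (-z₀) := by
    rw [← hconst y₀u, hz₀eq, hTpz₀, hTpnz₀]
  -- values: `Tp ∈ {0, 1}`
  have hTp01 : ∀ z, Tp z = 0 ∨ Tp z = 1 := by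
    intro z
    by_cases hz : Tp z = 0
    · exact Or.inl hz
    · rw [hTpval z hz]; exact h01 z
  -- the two cases `T z₀ - T(-z₀) = ±1`
  rcases h01 z₀ with h0 | h1
  · -- `T z₀ = 0`, `T(-z₀) = 1`: the fibre over `-b₀` is full
    have h1' : T (-z₀) = 1 := by
      rcases h01 (-z₀) with h | h
      · exact absurd (by rw [h, h0]) hz₀
      · exact h
    refine ⟨-b₀, hb₀u.neg, fun y ↦ ?_⟩
    have hD : Tp ((ZMod.chineseRemainder hc).symm ((-y : (ZMod p₀)ˣ), b₀)) -
        Tp (-(ZMod.chineseRemainder hc).symm ((-y : (ZMod p₀)ˣ), b₀)) = -1 := by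
      rw [hconst (-y), hDy₀, h0, h1']; ring
    have hneg : -(ZMod.chineseRemainder hc).symm (((-y : (ZMod p₀)ˣ) : ZMod p₀), b₀) =
        (ZMod.chineseRemainder hc).symm ((y : ZMod p₀), -b₀) := by
      rw [← crt_symm_neg, Units.val_neg, neg_neg]
    rw [hneg] at hD
    have hval : Tp ((ZMod.chineseRemainder hc).symm ((y : ZMod p₀), -b₀)) = 1 := by
      rcases hTp01 ((ZMod.chineseRemainder hc).symm ((y : ZMod p₀), -b₀)) with hb | hb
      · exfalso
        rcases hTp01 ((ZMod.chineseRemainder hc).symm (((-y : (ZMod p₀)ˣ) : ZMod p₀), b₀)) with ha | ha <;>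
          rw [ha, hb] at hD <;> norm_num at hD
      · exact hb
    rw [← hTpval _ (by rw [hval]; exact one_ne_zero), hval]
  · -- `T z₀ = 1`, `T(-z₀) = 0`: the fibre over `b₀` is full
    have h0' : T (-z₀) = 0 := by
      rcases h01 (-z₀) with h | h
      · exact h
      · exact absurd (by rw [h, h1]) hz₀
    refine ⟨b₀, hb₀u, fun y ↦ ?_⟩
    have hD : Tp ((ZMod.chineseRemainder hc).symm ((y : ZMod p₀), b₀)) -
        Tp (-(ZMod.chineseRemainder hc).symm ((y : ZMod p₀), b₀)) = 1 := by
      rw [hconst y, hDy₀, h1, h0']; ring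
    have hval : Tp ((ZMod.chineseRemainder hc).symm ((y : ZMod p₀), b₀)) = 1 := by
      rcases hTp01 ((ZMod.chineseRemainder hc).symm ((y : ZMod p₀), b₀)) with ha | ha
      · exfalso
        rcases hTp01 (-(ZMod.chineseRemainder hc).symm ((y : ZMod p₀), b₀)) with hb | hb <;>
          rw [ha, hb] at hD <;> norm_num at hD
      · exact ha
    rw [← hTpval _ (by rw [hval]; exact one_ne_zero), hval]

end Dichotomy

/-! ### The arithmetic kill: `p₀` is not annihilated by all odd primitive characters mod `n` -/

section Kill

variable {n : ℕ} [NeZero n]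

/-- **`p₀² ≢ 1 (mod n)`** when `n > 1` and every prime factor of `n` exceeds `p₀ + 1` (`p₀ ≥ 2`):
a prime `p' ∣ n` dividing `p₀² - 1 = (p₀ - 1)(p₀ + 1)` would be `≤ p₀ + 1`. [folklore] -/
theorem natCast_sq_ne_one_of_primeFactors_gt : ∀ {n : ℕ} [NeZero n] {p₀ : ℕ}, 2 ≤ p₀ → n ≠ 1 → (∀ p' ∈ n.primeFactors, p₀ + 1 < p') → ((p₀ : ℕ) : ZMod n) ^ 2 ≠ 1 := by
  intro n _ p₀ hp₀2 hn1 hbig h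
  have hn0 : n ≠ 0 := NeZero.ne n
  have h1 : ((p₀ ^ 2 - 1 : ℕ) : ZMod n) = 0 := by
    rw [Nat.cast_sub (Nat.one_le_pow _ _ (by omega)), Nat.cast_pow, h, Nat.cast_one, sub_self]
  rw [ZMod.natCast_eq_zero_iff] at h1
  obtain ⟨p', hp'⟩ := Nat.exists_prime_and_dvd hn1
  have hp'mem : p' ∈ n.primeFactors := Nat.mem_primeFactors.mpr ⟨hp'.1, hp'.2, hn0⟩
  have hbig' := hbig p' hp'mem
  have hdvd : p' ∣ (p₀ + 1) * (p₀ - 1) := by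
    have : p₀ ^ 2 - 1 = (p₀ + 1) * (p₀ - 1) := by simpa using Nat.sq_sub_sq p₀ 1
    rw [← this]
    exact dvd_trans hp'.2 h1
  rcases (Nat.Prime.dvd_mul hp'.1).mp hdvd with hd | hd
  · have := Nat.le_of_dvd (by omega) hd
    omega
  · have := Nat.le_of_dvd (by omega) hd
    omega

/-- **The kill.** Let `n > 1` be odd with all prime factors `≥ p₀ + 2`, `p₀ ≥ 2` coprime to `n`. Then
some odd primitive character `χ` mod `n` has `χ(p₀) ≠ 1` (Aoki's `U(n) ⊆ {w : w² = 1}`).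
[cite: Aoki1983, Prop. 6.1] -/
theorem exists_odd_isPrimitive_apply_natCast_ne_one {p₀ : ℕ} (hp₀2 : 2 ≤ p₀) (hn1 : n ≠ 1)
    (hnodd : Odd n) (hbig : ∀ p' ∈ n.primeFactors, p₀ + 1 < p') (hcop : p₀.Coprime n) :
    ∃ χ : DirichletCharacter ℂ n, χ.Odd ∧ χ.IsPrimitive ∧ χ ((p₀ : ℕ) : ZMod n) ≠ 1 := by
  have hn0 : n ≠ 0 := NeZero.ne n
  have hu : IsUnit ((p₀ : ℕ) : ZMod n) := (ZMod.isUnit_iff_coprime p₀ n).mpr hcop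
  have h15 : n ≠ 15 := by
    intro h
    have : 3 ∈ n.primeFactors := Nat.mem_primeFactors.mpr ⟨Nat.prime_three, by rw [h]; norm_num, hn0⟩
    have := hbig 3 this
    omega
  have h20 : n ≠ 20 := fun h ↦ by rw [h] at hnodd; exact (by decide : ¬ Odd 20) hnodd
  obtain ⟨χ, hχo, hχp, hχ⟩ := exists_odd_isPrimitive_apply_ne_one_of_sq_ne_one (Or.inl hnodd) h15 h20
    hu.unit (by rw [IsUnit.unit_spec]; exact natCast_sq_ne_one_of_primeFactors_gt hp₀2 hn1 hbig)
  exact ⟨χ, hχo, hχp, by rw [IsUnit.unit_spec] at hχ; exact hχ⟩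

end Kill

end PairedNull

end Summit.HodgeConjecture.HodgeConjecture.Theorems.CancelByAnyClaimLattice

end
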